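import Summits.QuantumFields.BalabanUV.T4Continuum.Support.NE7StraightPartOperator
import Summits.QuantumFields.BalabanUV.T4Continuum.Support.NE3EnergyHessBilin
import Summits.QuantumFields.BalabanUV.T4Continuum.Spine.NE3.LandauProjectionB8
import HarnessLib

/-!
# NE7BalabanSoftOperator — BAŁABAN's SOFT 1-FORM OPERATOR `Δ_a(W) = Hess_W + D_W·R(W)·D_W* + M⁻²·Qbar*·Qbar` ([B9] (3.26) SHAPE) ON ROW NE7's OWN CARRIER, AS LINEAR
# MAPS OF THE FINITE-DIMENSIONAL HILBERT SPACE OF SKEW TORUS 1-FORMS: the Riesz operator of the Wilson Hessian (`hessOpK`, and its symmetrisation `hessSymOpK`), the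
# straight linearised average `QbarIter L (j+1) W` (`qbarOpK`), the covariant gradient `D_W` (`gradOpK`), the [B8] (1.38) Landau projection = the orthogonal projection
# onto `Δ_W N(Q′(W))` (`landauProjK`), and the assembled `softOpK`∕`softSymOpK` — DATA definitions for the docking of (KL-B) to [B9] Thm 3.3∕3.11 TYPE letters about
# CONCRETE operators (file 121 of the curved (APE), F192)

Cell `pub-balaban`, rung (B)+1 sub-cell t4, lineage `b2b-balaban-t4-ne7-p1` (CRUX PROVER NE7 #1 = OWNER of row NE7), generation 85; memo
`t4/b2b-balaban-t4-ne7-p1-g85/LAGRANGE-CARRIER.md` §2.  Over row NE3's torus chart `NE3HilbertSchmidtTorus` (`Form`∕`Sec` = `ℓ²((ℤ∕P)^d, (M_n(ℂ), hsR))`, `extF`∕`resF`∕`extS`∕`resS`,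
`DW`, `inner_DW_right`), `NE3EnergyHessBilin` (`hessBilin`, `hessSym`), row NE3's `QbarIter_add`∕`QbarIter_smul` (`NE3CovariantLineSumsTower`∕`NE3SmoothRightInverseW`),
`NE7StraightPartOperator.QbarIter_skew`, `NE3LandauOrbit.gaugeDir_skew`, `Spine/NE3/PairLandauB8` (`IsLandauB8`, `avgKernelGauges`, `covLapSite`) BY NAME, and Mathlib's
finite-dimensional `LinearMap.adjoint` ∕ `Submodule.starProjection`.
WHY.  F166 `NE7ConstrainedGreenBalabanGauge.eq_source_of_gaugeFixed` turns a gauge-fixed hard-slice solution into `C_a h` for ABSTRACT linear maps `S = S₀ + D·Rp·Dᵀ + Qᵀ·A·Q`;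
F191 `NE7SliceLagrangeMultiplier` supplies the Lagrange form of (KL-B)'s slice equation.  To state the END's remaining letter as [B9] Thm 3.3∕(3.49)∕3.11 TYPE rows about
CONCRETE operators (positivity of `Δ_a(W)`; the curl row of `C_a(W) = G − GQ*(QGQ*)⁻¹QG`, `G = Δ_a(W)⁻¹`) the abstract letters must be INSTANTIATED on the tree's carrier; this
file fixes the instances once, as named data.  CONVENTIONS: unit lattice (no `η`); `M = L^{j+1}`; fine torus `P = N·M`, coarse torus `N`; `a = 1` so the mass term is `M⁻²·Qbar*Qbar`
([B9] (3.26) «a(L^kη)^{−2}Q*Q» at `L^kη = 1∕…` read on the unit lattice); the Hessian is the tree's MIXED second variation `hess W X Y = ∂_s∂_t A(W e^{sX} e^{tY})` in the FIRST-slot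
convention `⟪hessOpK b, c⟫ = hess W (extF b) (extF c)` (its symmetrisation `hessSymOpK` is print's quadratic-form operator; the difference is first-variation-sized, a later file).
WHAT (DATA definitions + their defining identities; [folklore]; 0 sorry).  §1 `rieszOp` (generic: the operator of a bilinear form on a finite-dimensional real Hilbert space, via
`LinearMap.adjoint`; `inner_rieszOp_left`).  §2 `skewForms P`, `skewSecs P` (the skew torus 1-forms ∕ sections as submodules; `NE7SkewTorusForms.exists_skewForms` made canonical).
§3 `hessFormK`∕`hessOpK`∕`hessSymFormK`∕`hessSymOpK` (`inner_hessOpK_left`, `inner_hessSymOpK_left`).  §4 `qbarOpK` (`coe_qbarOpK`; class lines as arguments — they make `QbarIter`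
linear).  §5 `gradOpK` (`coe_gradOpK`, `inner_gradOpK_right`).  §6 `landauTestsK` (the span of `resS (Δ_W μ)`, `μ ∈ N(Q′(W))`), `landauProjK` (its orthogonal projection;
`landauProjK_apply_eq_zero_iff`).  §7 `gaugeFixK`, `massK`, `softOpK`, `softSymOpK` (`softOpK_apply`, `softSymOpK_apply` — F166's `hS` shape literally).
HONEST FRAMING (page 1): DATA and unfolding lemmas only; NO estimate; positivity ∕ invertibility of `softOpK` ([B9] Thm 3.11 TYPE) and the rows of its constrained inverse ([B9] Thm
3.3∕(3.49) TYPE) are NOT asserted; the identification with print's operators through lit-balaban's junction modules (J-A∕J-B) is NOT made here; (KL-B) at curved `W` NOT proved;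
(APE) on curved data NOT proved; NOT ONE-STEP, NOT NE7; spine 0∕9; finite T⁴ rung (B)+1 — NOT infinite volume, NOT mass gap, NOT `BetaPertH`, NOT Clay.  Continuum YM on T⁴ ⇐
BetaPertH ∧ nine spine estimates (0/9 proved); BetaPertH ⇐ (D1) ∧ (D4) ∧ CAP+tail; G-an2-4 gates asym, D1 and NE2/3/4.
-/

set_option autoImplicit false

open scoped BigOperators InnerProductSpace Matrix Matrix.Norms.L2Operator
open Finset

namespace Summit.QuantumFields.BalabanUV.T4Continuum.NE7BalabanSoftOperator

open Literature.MathematicalPhysics.QuantumFieldTheory.Balaban1983to89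
open B7Prop1Explicit B7Prop2Explicit UnitaryModel
open T4AveragingDeficitWall (IsUnitaryCfg IsSkewDir SmallField)
open T4AveragingDeficitWallBoundary (periodBox IsPeriodicCfg)
open AveragingDeficitPeriodicCounting (IsPeriodicDir)
open AveragingDeficitMultiLevelPrep (LevelSmall)
open MinimalActionLevels (perWin)
open BlockAveragePushDirGauge (gaugeDir)
open NE3HessForm (hess)
open NE3EnergyHessBilin (hessBilin hessBilin_apply hessSym hessSym_apply)
open NE3TangentCovariantTower (QbarIter)
open NE3CovariantLineSumsTower (QbarIter_add)
open NE3SmoothRightInverseW (QbarIter_smul)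
open NE3CovariantCalculus (hsR)
open NE3HilbertSchmidtTorus
open NE7SkewTorusForms (isSkewDir_extF_resF)
open NE7CombLineSumCoercive (resF_smul)
open NE7StraightPartOperator (QbarIter_skew)
open NE3LandauOrbit (gaugeDir_skew)
open NE3.PairLandauB8 (IsLandauB8 avgKernelGauges covLapSite)

noncomputable section

/-! ## §1 The operator of a bilinear form on a finite-dimensional real Hilbert space -/

section Riesz

variable {V : Type*} [NormedAddCommGroup V] [InnerProductSpace ℝ V] [FiniteDimensional ℝ V]

/-- **THE RIESZ OPERATOR OF A BILINEAR FORM**: `⟪rieszOp B v, w⟫ = B v w` (first slot fixed), via the finite-dimensional adjoint of the functional `B v : V → ℝ`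
evaluated at `1`. A DATA definition. [folklore] -/
def rieszOp (B : V →ₗ[ℝ] V →ₗ[ℝ] ℝ) : V →ₗ[ℝ] V where
  toFun v := LinearMap.adjoint (B v) 1
  map_add' v v' := by rw [map_add, map_add, LinearMap.add_apply]
  map_smul' t v := by
    rw [LinearMap.map_smul, LinearEquiv.map_smulₛₗ, LinearMap.smul_apply, RingHom.id_apply, starRingEnd_apply, star_trivial]

/-- `⟪rieszOp B v, w⟫ = B v w`. [folklore] -/
theorem inner_rieszOp_left (B : V →ₗ[ℝ] V →ₗ[ℝ] ℝ) (v w : V) : ⟪rieszOp B v, w⟫_ℝ = B v w := by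
  show ⟪LinearMap.adjoint (B v) 1, w⟫_ℝ = B v w
  rw [LinearMap.adjoint_inner_left]
  simp

/-- `⟪w, rieszOp B v⟫ = B v w`. [folklore] -/
theorem inner_rieszOp_right (B : V →ₗ[ℝ] V →ₗ[ℝ] ℝ) (v w : V) : ⟪w, rieszOp B v⟫_ℝ = B v w := by
  rw [real_inner_comm, inner_rieszOp_left]

end Riesz

/-! ## §2 The skew torus 1-forms and sections as submodules -/

variable {d : ℕ} {n : Type*} [Fintype n] [DecidableEq n]

variable (d n) in
/-- **THE SKEW TORUS 1-FORMS**: `b ∈ skewForms P ⟺ extF P b` is skew (`NE7SkewTorusForms.exists_skewForms` as a named submodule). A DATA definition. [folklore] -/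
def skewForms (P : ℕ) [NeZero P] : Submodule ℝ (Form d n P) where
  carrier := {b | IsSkewDir (extF P b)}
  add_mem' := fun {a b} ha hb x κ => by
    rw [extF_add]; exact (skewAdjoint (Matrix n n ℂ)).add_mem (ha x κ) (hb x κ)
  zero_mem' := fun x κ => by
    show extF P (0 : Form d n P) x κ ∈ skewAdjoint (Matrix n n ℂ)
    exact (skewAdjoint (Matrix n n ℂ)).zero_mem
  smul_mem' := fun t b hb x κ => by
    show t • extF P b x κ ∈ skewAdjoint (Matrix n n ℂ)
    exact skewAdjoint.smul_mem t (hb x κ)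

omit [Fintype n] [DecidableEq n] in
/-- Membership in `skewForms`, unfolded. [folklore] -/
theorem mem_skewForms {P : ℕ} [NeZero P] {b : Form d n P} : b ∈ skewForms d n P ↔ IsSkewDir (extF P b) := Iff.rfl

variable (d n) in
/-- **THE SKEW TORUS SECTIONS**: `a ∈ skewSecs P ⟺ extS P a` is skew at every site. A DATA definition. [folklore] -/
def skewSecs (P : ℕ) [NeZero P] : Submodule ℝ (Sec d n P) where
  carrier := {a | ∀ y : Site d, extS P a y ∈ skewAdjoint (Matrix n n ℂ)}
  add_mem' := fun {a b} ha hb y => by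
    rw [extS_add]; exact (skewAdjoint (Matrix n n ℂ)).add_mem (ha y) (hb y)
  zero_mem' := fun y => by
    show extS P (0 : Sec d n P) y ∈ skewAdjoint (Matrix n n ℂ)
    exact (skewAdjoint (Matrix n n ℂ)).zero_mem
  smul_mem' := fun t a ha y => by
    rw [extS_smul]; exact skewAdjoint.smul_mem t (ha y)

omit [Fintype n] [DecidableEq n] in
/-- Membership in `skewSecs`, unfolded. [folklore] -/
theorem mem_skewSecs {P : ℕ} [NeZero P] {a : Sec d n P} : a ∈ skewSecs d n P ↔ ∀ y : Site d, extS P a y ∈ skewAdjoint (Matrix n n ℂ) := Iff.rfl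

omit [Fintype n] [DecidableEq n] in
/-- The restriction of a skew periodic direction field is a skew torus 1-form. [folklore] -/
theorem resF_mem_skewForms {P : ℕ} [NeZero P] {Y : Site d → Fin d → Matrix n n ℂ} (hY : IsSkewDir Y) : resF P Y ∈ skewForms d n P :=
  isSkewDir_extF_resF P hY

omit [Fintype n] [DecidableEq n] in
/-- The restriction of a skew `P`-periodic site field is a skew torus section. [folklore] -/
theorem resS_mem_skewSecs {P : ℕ} [NeZero P] {f : Site d → Matrix n n ℂ} (hf : ∀ y, f y ∈ skewAdjoint (Matrix n n ℂ))
    (hfP : ∀ (x : Site d) (τ : Fin d), f (x + (P : ℤ) • e τ) = f x) : resS P f ∈ skewSecs d n P := by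
  intro y
  rw [extS_resS P hfP]
  exact hf y

omit [Fintype n] [DecidableEq n] in
/-- `extF` as a real linear map. A DATA definition. [folklore] -/
def extFL (P : ℕ) [NeZero P] : Form d n P →ₗ[ℝ] (Site d → Fin d → Matrix n n ℂ) where
  toFun := extF P
  map_add' _ _ := rfl
  map_smul' _ _ := rfl

omit [Fintype n] [DecidableEq n] in
/-- `extFL P b = extF P b`. [folklore] -/
@[simp] theorem extFL_apply (P : ℕ) [NeZero P] (b : Form d n P) : extFL (d := d) (n := n) P b = extF P b := rfl

/-! ## §3 The Wilson Hessian at `W` as a form ∕ operator on the skew torus 1-forms -/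

/-- **THE HESSIAN FORM ON THE SKEW TORUS 1-FORMS**: `hessFormK W P b c = hess W (extF b) (extF c) (perWin d P)` (mixed second variation, first-slot convention).
A DATA definition. [folklore] -/
def hessFormK (W : Site d → Fin d → (Matrix n n ℂ)ˣ) (P : ℕ) [NeZero P] : skewForms d n P →ₗ[ℝ] skewForms d n P →ₗ[ℝ] ℝ :=
  (hessBilin W (perWin d P)).compl₁₂ (extFL P ∘ₗ (skewForms d n P).subtype) (extFL P ∘ₗ (skewForms d n P).subtype)

/-- `hessFormK W P b c = hess W (extF b) (extF c) (perWin d P)`. [folklore] -/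
@[simp] theorem hessFormK_apply (W : Site d → Fin d → (Matrix n n ℂ)ˣ) (P : ℕ) [NeZero P] (b c : skewForms d n P) :
    hessFormK W P b c = hess W (extF P (b : Form d n P)) (extF P (c : Form d n P)) (perWin d P) := rfl

/-- **THE HESSIAN OPERATOR** `Hess_W` on the skew torus 1-forms: `⟪hessOpK W P b, c⟫ = hess W (extF b) (extF c) (perWin d P)`. A DATA definition. [folklore] -/
def hessOpK (W : Site d → Fin d → (Matrix n n ℂ)ˣ) (P : ℕ) [NeZero P] : skewForms d n P →ₗ[ℝ] skewForms d n P :=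
  rieszOp (hessFormK W P)

/-- `⟪hessOpK W P b, c⟫ = hess W (extF b) (extF c) (perWin d P)`. [folklore] -/
theorem inner_hessOpK_left (W : Site d → Fin d → (Matrix n n ℂ)ˣ) (P : ℕ) [NeZero P] (b c : skewForms d n P) :
    ⟪hessOpK W P b, c⟫_ℝ = hess W (extF P (b : Form d n P)) (extF P (c : Form d n P)) (perWin d P) := by
  rw [hessOpK, inner_rieszOp_left, hessFormK_apply]

/-- **THE SYMMETRISED HESSIAN FORM** on the skew torus 1-forms: `hessSymFormK W P b c = (hess W b c + hess W c b)∕2` (print's quadratic-form convention). A DATA definition.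
[folklore] -/
def hessSymFormK (W : Site d → Fin d → (Matrix n n ℂ)ˣ) (P : ℕ) [NeZero P] : skewForms d n P →ₗ[ℝ] skewForms d n P →ₗ[ℝ] ℝ :=
  (hessSym W (perWin d P)).compl₁₂ (extFL P ∘ₗ (skewForms d n P).subtype) (extFL P ∘ₗ (skewForms d n P).subtype)

/-- `hessSymFormK W P b c = (hess W (extF b) (extF c) + hess W (extF c) (extF b))∕2`. [folklore] -/
theorem hessSymFormK_apply (W : Site d → Fin d → (Matrix n n ℂ)ˣ) (P : ℕ) [NeZero P] (b c : skewForms d n P) :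
    hessSymFormK W P b c = (hess W (extF P (b : Form d n P)) (extF P (c : Form d n P)) (perWin d P)
      + hess W (extF P (c : Form d n P)) (extF P (b : Form d n P)) (perWin d P)) / 2 := by
  show hessSym W (perWin d P) (extF P (b : Form d n P)) (extF P (c : Form d n P)) = _
  rw [hessSym_apply]

/-- **THE SYMMETRISED HESSIAN OPERATOR** (print's `Δ(U)` of [B9] (3.4)∕(3.9) TYPE, on our carrier): `⟪hessSymOpK W P b, c⟫ = hessSymFormK W P b c`. A DATA definition.
[folklore] -/
def hessSymOpK (W : Site d → Fin d → (Matrix n n ℂ)ˣ) (P : ℕ) [NeZero P] : skewForms d n P →ₗ[ℝ] skewForms d n P :=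
  rieszOp (hessSymFormK W P)

/-- `⟪hessSymOpK W P b, c⟫ = (hess W (extF b) (extF c) + hess W (extF c) (extF b))∕2`. [folklore] -/
theorem inner_hessSymOpK_left (W : Site d → Fin d → (Matrix n n ℂ)ˣ) (P : ℕ) [NeZero P] (b c : skewForms d n P) :
    ⟪hessSymOpK W P b, c⟫_ℝ = (hess W (extF P (b : Form d n P)) (extF P (c : Form d n P)) (perWin d P)
      + hess W (extF P (c : Form d n P)) (extF P (b : Form d n P)) (perWin d P)) / 2 := by
  rw [hessSymOpK, inner_rieszOp_left, hessSymFormK_apply]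

/-! ## §4 The straight linearised average `QbarIter L (j+1) W` on the skew torus 1-forms -/

section Qbar

/-- The positivity instance for the fine period `N·L^{j+1}` (to be introduced with `haveI` by users). [folklore] -/
theorem neZero_fine (N L j : ℕ) [NeZero N] (hL : 1 ≤ L) : NeZero (N * L ^ (j + 1)) :=
  ⟨Nat.mul_ne_zero (NeZero.ne N) (pow_ne_zero _ (by omega))⟩

variable [Nonempty n] {L N : ℕ} [NeZero N] (hL : 1 ≤ L) (j : ℕ) [NeZero (N * L ^ (j + 1))]
  {W : Site d → Fin d → (Matrix n n ℂ)ˣ} {x : ℝ} (hWu : IsUnitaryCfg W) (hx : 0 ≤ x) (hs : LevelSmall d L j x) (hWx : SmallField W x)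

/-- **`QbarIter L (j+1) W` AS A LINEAR MAP OF THE TORUS 1-FORMS** (fine period `N·L^{j+1}` → coarse period `N`): extend periodically, average, restrict.  The class lines
`hWu hx hs hWx` are ARGUMENTS — they make the tree's `QbarIter` additive and real-homogeneous (`QbarIter_add`, `QbarIter_smul`). A DATA definition. [folklore] -/
def qbarOp₀K : Form d n (N * L ^ (j + 1)) →ₗ[ℝ] Form d n N :=
  { toFun := fun b => resF N (QbarIter L (j + 1) W (extF (N * L ^ (j + 1)) b))
    map_add' := fun a b => by
      have h : extF (N * L ^ (j + 1)) (a + b) = fun y μ => extF (N * L ^ (j + 1)) a y μ + extF (N * L ^ (j + 1)) b y μ := rfl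
      rw [h, QbarIter_add hL j hWu hx hs hWx, resF_add]
    map_smul' := fun t b => by
      have h : extF (N * L ^ (j + 1)) (t • b) = t • extF (N * L ^ (j + 1)) b := rfl
      rw [h, QbarIter_smul hL j hWu hx hs hWx, RingHom.id_apply]
      exact resF_smul N t _ }

omit [NeZero N] in
/-- `qbarOp₀K b = resF N (QbarIter L (j+1) W (extF b))`. [folklore] -/
theorem qbarOp₀K_apply (b : Form d n (N * L ^ (j + 1))) :
    qbarOp₀K hL j hWu hx hs hWx b = resF N (QbarIter L (j + 1) W (extF (N * L ^ (j + 1)) b)) := rfl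

/-- It maps skew forms to skew forms (`QbarIter_skew`). [folklore] -/
theorem qbarOp₀K_mem (b : Form d n (N * L ^ (j + 1))) (hb : b ∈ skewForms d n (N * L ^ (j + 1))) :
    qbarOp₀K (N := N) hL j hWu hx hs hWx b ∈ skewForms d n N := by
  rw [qbarOp₀K_apply, mem_skewForms]
  exact isSkewDir_extF_resF N (QbarIter_skew hL j hWu hx hs hWx hb)

/-- **`Qbar` ON THE SKEW TORUS 1-FORMS**: the restriction of `qbarOp₀K` to `skewForms (N·L^{j+1}) → skewForms N`. A DATA definition. [folklore] -/
def qbarOpK : skewForms d n (N * L ^ (j + 1)) →ₗ[ℝ] skewForms d n N :=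
  ((qbarOp₀K hL j hWu hx hs hWx).domRestrict (skewForms d n (N * L ^ (j + 1)))).codRestrict (skewForms d n N)
    fun b => qbarOp₀K_mem hL j hWu hx hs hWx b.1 b.2

/-- `(qbarOpK b : Form N) = resF N (QbarIter L (j+1) W (extF b))`. [folklore] -/
theorem coe_qbarOpK (b : skewForms d n (N * L ^ (j + 1))) :
    ((qbarOpK hL j hWu hx hs hWx b : skewForms d n N) : Form d n N) = resF N (QbarIter L (j + 1) W (extF (N * L ^ (j + 1)) (b : Form d n (N * L ^ (j + 1))))) :=
  rfl

end Qbar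

/-! ## §5 The covariant gradient `D_W` on the skew torus sections -/

/-- `D_W` maps skew sections to skew 1-forms at a unitary `W` (`gaugeDir_skew`). [folklore] -/
theorem DW_mem_skewForms {W : Site d → Fin d → (Matrix n n ℂ)ˣ} (hWu : IsUnitaryCfg W) (P : ℕ) [NeZero P] (a : skewSecs d n P) :
    DW W P (a : Sec d n P) ∈ skewForms d n P := by
  rw [mem_skewForms, DW_apply]
  exact isSkewDir_extF_resF P (gaugeDir_skew hWu a.2)

/-- **`D_W` ON THE SKEW TORUS SECTIONS**: `skewSecs P → skewForms P`, the restriction of row NE3's `DW W P`. A DATA definition. [folklore] -/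
def gradOpK {W : Site d → Fin d → (Matrix n n ℂ)ˣ} (hWu : IsUnitaryCfg W) (P : ℕ) [NeZero P] : skewSecs d n P →ₗ[ℝ] skewForms d n P :=
  ((DW W P).domRestrict (skewSecs d n P)).codRestrict (skewForms d n P) (DW_mem_skewForms hWu P)

/-- `(gradOpK a : Form P) = DW W P a`. [folklore] -/
theorem coe_gradOpK {W : Site d → Fin d → (Matrix n n ℂ)ˣ} (hWu : IsUnitaryCfg W) (P : ℕ) [NeZero P] (a : skewSecs d n P) :
    ((gradOpK hWu P a : skewForms d n P) : Form d n P) = DW W P (a : Sec d n P) := rfl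

/-- `⟪b, gradOpK a⟫ = Σ_{x ∈ periodBox P} Σ_κ hsR (extF b x κ) (gaugeDir W (extS a) x κ)` — the pairing of `IsLandauB8`. [folklore] -/
theorem inner_gradOpK_right {W : Site d → Fin d → (Matrix n n ℂ)ˣ} (hWu : IsUnitaryCfg W) (P : ℕ) [NeZero P] (b : skewForms d n P) (a : skewSecs d n P) :
    ⟪b, gradOpK hWu P a⟫_ℝ = ∑ x ∈ periodBox (d := d) P, ∑ κ : Fin d, hsR (extF P (b : Form d n P) x κ) (gaugeDir W (extS P (a : Sec d n P)) x κ) := by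
  rw [Submodule.coe_inner, coe_gradOpK, inner_DW_right]

/-! ## §6 The [B8] (1.38) test space `Δ_W N(Q′(W))` on the torus and its orthogonal projection -/

/-- **THE LANDAU TEST SECTIONS** at level `k`, period `N·L^k`: the span of the restrictions `resS (Δ_W μ)` of the covariant site Laplacians of the members `μ` of B8's test space
`N(Q′(W))` (`avgKernelGauges L N k W`) — print's `Δ_U N(Q′_k(U))` ([B8] p. 80) on the torus chart. A DATA definition. [folklore] -/
def landauTestsK (L N k : ℕ) [NeZero (N * L ^ k)] (W : Site d → Fin d → (Matrix n n ℂ)ˣ) : Submodule ℝ (skewSecs d n (N * L ^ k)) :=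
  Submodule.span ℝ {a : skewSecs d n (N * L ^ k) | ∃ μ ∈ avgKernelGauges (d := d) (n := n) L N k W, (a : Sec d n (N * L ^ k)) = resS (N * L ^ k) (covLapSite W μ)}

/-- **THE [B8] (1.38) LANDAU PROJECTION `R(W)` ON THE SKEW TORUS SECTIONS**: the orthogonal projection onto `landauTestsK` (Mathlib's `Submodule.starProjection`; the
finite-dimensional span is complete). A DATA definition. [folklore] -/
def landauProjK (L N k : ℕ) [NeZero (N * L ^ k)] (W : Site d → Fin d → (Matrix n n ℂ)ˣ) : skewSecs d n (N * L ^ k) →ₗ[ℝ] skewSecs d n (N * L ^ k) :=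
  haveI : CompleteSpace (landauTestsK (d := d) (n := n) L N k W) := FiniteDimensional.complete ℝ _
  ((landauTestsK (d := d) (n := n) L N k W).starProjection : skewSecs d n (N * L ^ k) →L[ℝ] skewSecs d n (N * L ^ k)).toLinearMap

/-- `landauProjK a = 0 ⟺ a ⊥ landauTestsK`. [folklore] -/
theorem landauProjK_apply_eq_zero_iff (L N k : ℕ) [NeZero (N * L ^ k)] (W : Site d → Fin d → (Matrix n n ℂ)ˣ) (a : skewSecs d n (N * L ^ k)) :
    landauProjK L N k W a = 0 ↔ a ∈ (landauTestsK (d := d) (n := n) L N k W)ᗮ := by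
  haveI : CompleteSpace (landauTestsK (d := d) (n := n) L N k W) := FiniteDimensional.complete ℝ _
  exact Submodule.starProjection_apply_eq_zero_iff (K := landauTestsK (d := d) (n := n) L N k W) (v := a)

/-- `landauProjK` is idempotent. [folklore] -/
theorem landauProjK_idem (L N k : ℕ) [NeZero (N * L ^ k)] (W : Site d → Fin d → (Matrix n n ℂ)ˣ) (a : skewSecs d n (N * L ^ k)) :
    landauProjK L N k W (landauProjK L N k W a) = landauProjK L N k W a := by
  haveI : CompleteSpace (landauTestsK (d := d) (n := n) L N k W) := FiniteDimensional.complete ℝ _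
  have h := (landauTestsK (d := d) (n := n) L N k W).isIdempotentElem_starProjection
  exact congrArg (fun T : skewSecs d n (N * L ^ k) →L[ℝ] skewSecs d n (N * L ^ k) => T a) h.eq

/-- `landauProjK` is symmetric. [folklore] -/
theorem inner_landauProjK_left (L N k : ℕ) [NeZero (N * L ^ k)] (W : Site d → Fin d → (Matrix n n ℂ)ˣ) (a a' : skewSecs d n (N * L ^ k)) :
    ⟪landauProjK L N k W a, a'⟫_ℝ = ⟪a, landauProjK L N k W a'⟫_ℝ := by
  haveI : CompleteSpace (landauTestsK (d := d) (n := n) L N k W) := FiniteDimensional.complete ℝ _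
  exact Submodule.inner_starProjection_left_eq_right _ a a'

/-! ## §7 The assembled soft operators `Δ_a(W)` ([B9] (3.26) SHAPE) -/

section Soft

variable [Nonempty n] {L N : ℕ} [NeZero N] (hL : 1 ≤ L) (j : ℕ) [NeZero (N * L ^ (j + 1))]
  {W : Site d → Fin d → (Matrix n n ℂ)ˣ} {x : ℝ} (hWu : IsUnitaryCfg W) (hx : 0 ≤ x) (hs : LevelSmall d L j x) (hWx : SmallField W x)

/-- **THE GAUGE-FIXING TERM** `D_W · R(W) · D_W*` on the skew torus 1-forms of period `N·L^{j+1}` (`*` = the finite-dimensional adjoint). A DATA definition. [folklore] -/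
def gaugeFixK : skewForms d n (N * L ^ (j + 1)) →ₗ[ℝ] skewForms d n (N * L ^ (j + 1)) :=
  gradOpK hWu (N * L ^ (j + 1)) ∘ₗ landauProjK L N (j + 1) W
    ∘ₗ (LinearMap.adjoint (𝕜 := ℝ) (E := skewSecs d n (N * L ^ (j + 1))) (F := skewForms d n (N * L ^ (j + 1))) (gradOpK hWu (N * L ^ (j + 1)))
          : skewForms d n (N * L ^ (j + 1)) →ₗ[ℝ] skewSecs d n (N * L ^ (j + 1)))

/-- **THE MASS TERM** `M⁻²·Qbar*·Qbar`, `M = L^{j+1}` ([B9] (3.26) at `a = 1`, unit lattice). A DATA definition. [folklore] -/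
def massK : skewForms d n (N * L ^ (j + 1)) →ₗ[ℝ] skewForms d n (N * L ^ (j + 1)) :=
  ((((L : ℝ) ^ (j + 1)) ^ 2)⁻¹) •
    ((LinearMap.adjoint (𝕜 := ℝ) (E := skewForms d n (N * L ^ (j + 1))) (F := skewForms d n N) (qbarOpK (N := N) hL j hWu hx hs hWx)
        : skewForms d n N →ₗ[ℝ] skewForms d n (N * L ^ (j + 1)))
      ∘ₗ qbarOpK (N := N) hL j hWu hx hs hWx)

/-- **BAŁABAN's SOFT OPERATOR ON OUR CARRIER (mixed-Hessian convention)**: `softOpK = Hess_W + D_W R(W) D_W* + M⁻² Qbar*Qbar`. A DATA definition. [folklore] -/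
def softOpK : skewForms d n (N * L ^ (j + 1)) →ₗ[ℝ] skewForms d n (N * L ^ (j + 1)) :=
  hessOpK W (N * L ^ (j + 1)) + gaugeFixK (L := L) (N := N) j hWu + massK (N := N) hL j hWu hx hs hWx

/-- **BAŁABAN's SOFT OPERATOR ON OUR CARRIER (symmetric convention, print's `Δ_a(U)` TYPE)**: `softSymOpK = HessSym_W + D_W R(W) D_W* + M⁻² Qbar*Qbar`. A DATA
definition. [folklore] -/
def softSymOpK : skewForms d n (N * L ^ (j + 1)) →ₗ[ℝ] skewForms d n (N * L ^ (j + 1)) :=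
  hessSymOpK W (N * L ^ (j + 1)) + gaugeFixK (L := L) (N := N) j hWu + massK (N := N) hL j hWu hx hs hWx

/-- `softOpK y = Hess y + D(R(D* y)) + Qbar*(M⁻² • Qbar y)` — the hypothesis `hS` of F166 `eq_source_of_gaugeFixed` with `S₀ = hessOpK`, `D = gradOpK`, `Rp = landauProjK`,
`Dt = D*`, `Qt = Qbar*`, `A = M⁻²·id`. [folklore] -/
theorem softOpK_apply (y : skewForms d n (N * L ^ (j + 1))) :
    softOpK hL j hWu hx hs hWx y
      = hessOpK W (N * L ^ (j + 1)) y
        + gradOpK hWu (N * L ^ (j + 1)) (landauProjK L N (j + 1) W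
            ((LinearMap.adjoint (𝕜 := ℝ) (E := skewSecs d n (N * L ^ (j + 1))) (F := skewForms d n (N * L ^ (j + 1))) (gradOpK hWu (N * L ^ (j + 1)))
                : skewForms d n (N * L ^ (j + 1)) →ₗ[ℝ] skewSecs d n (N * L ^ (j + 1))) y))
        + (LinearMap.adjoint (𝕜 := ℝ) (E := skewForms d n (N * L ^ (j + 1))) (F := skewForms d n N) (qbarOpK (N := N) hL j hWu hx hs hWx)
              : skewForms d n N →ₗ[ℝ] skewForms d n (N * L ^ (j + 1)))
            (((((L : ℝ) ^ (j + 1)) ^ 2)⁻¹ • LinearMap.id (R := ℝ) (M := skewForms d n N)) (qbarOpK (N := N) hL j hWu hx hs hWx y)) := by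
  simp only [softOpK, gaugeFixK, massK, LinearMap.add_apply, LinearMap.comp_apply, LinearMap.smul_apply, LinearMap.id_apply, LinearMap.map_smul]

/-- The same for the symmetric convention. [folklore] -/
theorem softSymOpK_apply (y : skewForms d n (N * L ^ (j + 1))) :
    softSymOpK hL j hWu hx hs hWx y
      = hessSymOpK W (N * L ^ (j + 1)) y
        + gradOpK hWu (N * L ^ (j + 1)) (landauProjK L N (j + 1) W
            ((LinearMap.adjoint (𝕜 := ℝ) (E := skewSecs d n (N * L ^ (j + 1))) (F := skewForms d n (N * L ^ (j + 1))) (gradOpK hWu (N * L ^ (j + 1)))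
                : skewForms d n (N * L ^ (j + 1)) →ₗ[ℝ] skewSecs d n (N * L ^ (j + 1))) y))
        + (LinearMap.adjoint (𝕜 := ℝ) (E := skewForms d n (N * L ^ (j + 1))) (F := skewForms d n N) (qbarOpK (N := N) hL j hWu hx hs hWx)
              : skewForms d n N →ₗ[ℝ] skewForms d n (N * L ^ (j + 1)))
            (((((L : ℝ) ^ (j + 1)) ^ 2)⁻¹ • LinearMap.id (R := ℝ) (M := skewForms d n N)) (qbarOpK (N := N) hL j hWu hx hs hWx y)) := by
  simp only [softSymOpK, gaugeFixK, massK, LinearMap.add_apply, LinearMap.comp_apply, LinearMap.smul_apply, LinearMap.id_apply, LinearMap.map_smul]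

end Soft

end

end Summit.QuantumFields.BalabanUV.T4Continuum.NE7BalabanSoftOperator
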